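import Literature.Analysis.FluidPDE.HeatKernelSideFibre
import HarnessLib

/-!
# The fibre integral of the three-dimensional Oseen kernel is the two-dimensional Oseen kernel

Analysis/FluidPDE support file (all results proved) for the planar reduction in Step 5 of the
proof of Koch–Nadirashvili–Seregin–Šverák 2009, Theorem 6.2 (arXiv:0709.3599, p. 13: Theorem 5.1
and Remark 6.1 are applied "to the field `(w₁, w₃)`" of a three-dimensional ancient mild solution
`w` independent of `x₂`). The mild formulation is the representation formula (3.3) with the
kernel `K_{ijk}` (§3, p. 6), in the tree the closed Gaussian form `oseenKernel τ z a b` of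
Koch–Tataru (`KochTataru.lean`). The identity proved here is the kernel-level content of that
reduction: for `τ > 0`, `w ∈ ℝ²` and tensor slots `a = ι a' + a₁ e₁`, `b = ι b' + b₁ e₁`,

  `∫ K³(τ, (w₀, r, w₁))[a, b] dr = ι (K²(τ, w)[a', b']) + (−⟪w, a'⟫ G²_τ(w) b₁ / (2τ)) e₁`

(`integral_oseenKernel_fiber`, `integral_oseenKernel_fiber'`): the planar part of the fibre
integral of the three-dimensional kernel is the two-dimensional kernel on the planar parts, and
its axial part is the planar transport term of the passive scalar `b₁`. Proof: the integrand is
`E(r) + r • O(r)` with `E`, `O` even in `r`, so the integral is `∫ E`; the even part integrates by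
`∫ G³ dr = G²`, `∫ A³ dr = A²`, `∫ B³ dr = B²` and the Gaussian moment identity `∫ r² B³ dr = A²`
of `HeatKernelSideFibre`, after which the `a₁ b₁`-terms cancel (`module`).

## Mathlib / tree search

`OseenKernelLineIntegrals` (§Kernel) proves the two *special* fibre integrals that its route to the
same step needs — `∫ K(σ, z' + re)[e, b] dr = 0` (`integral_oseenKernel_line_left`) and
`⟪∫ K(σ, z' + re)[a, e] dr, v⟫ = 0` for `v ⊥ e` (`inner_integral_oseenKernel_line_right`) —, by
the same even/odd splitting and the same moment identity. The present file proves the *general*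
two-slot identity (arbitrary `a`, `b`; both the planar and the axial part of the fibre integral),
of which those are the cases `a' = 0` resp. the planar part for `b' = 0`; the general identity is
what turns the three-dimensional Oseen identity of a field independent of `x₂` into the
two-dimensional Oseen identity of its planar trace (`OseenPlanarReduction`,
`KNSSTypeIRateLiouvilleOfPlanar`: the trace is then a planar *mild*, hence weak, solution, the input of
Theorem 5.1), rather than only killing the Duhamel terms of axial data. Integrability along the
fibres (`integrable_oseenKernel_fiber`) is Koch–Tataru's bound (14) as in
`integrable_oseenKernel_line` of that file (`exists_norm_oseenKernel_le`,
`integrable_add_norm_sq_rpow_neg`, `KochTataruKernel`).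

## References

* G. Koch, N. Nadirashvili, G. Seregin, V. Šverák, *Liouville theorems for the Navier–Stokes
  equations and applications*, Acta Math. 203 (2009) 83–105 = arXiv:0709.3599: proof of
  Theorem 6.2, p. 13 ("since the solutions `v⁽ᵏ⁾` are axi-symmetric and `M_k ↗ ∞`, it is easy to see
  that `w` is independent of the `x₂`-variable. Applying Theorem 5.1 and Remark 6.1 to the field
  `(w₁, w₃)`, we conclude that `(w₁, w₃)` must vanish identically, and this easily implies that
  `w = 0`"); §3, p. 6 (the kernel `K_{ijk}` of the representation formula (3.3)); §4, p. 8 (the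
  bilinear form `B`). [KochNadirashviliSereginSverak2009]
* H. Koch, D. Tataru, *Well-posedness for the Navier–Stokes equations*, Adv. Math. 157 (2001),
  §2 (6)–(8) (the Gaussian form of the kernel of `e^{τΔ}Π∇·`), §3 (14) (its decay).
  [KochTataruAdvMath2001]
-/

noncomputable section

open MeasureTheory Set Function Filter WithLp Real
open scoped RealInnerProductSpace ENNReal NNReal

namespace Literature.Analysis.FluidPDE

/-! ### The fibre integral of the kernel -/

section KernelFiber

/-- The integrand is measurable in the fibre variable. [folklore] -/
theorem measurable_oseenKernel_fiber (τ : ℝ) (z' : (EuclideanSpace ℝ (Fin 2))) (a b : (EuclideanSpace ℝ (Fin 3))) :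
    Measurable (fun r : ℝ => oseenKernel τ (sideSplit.symm (r, z')) a b) :=
  (measurable_oseenKernel_left τ a b).comp
    (sideSplit.symm.measurable.comp (measurable_id.prodMk measurable_const))

/-- Integrability along the fibre (from the kernel bound (14)). [cite: KochTataruAdvMath2001, §3 (14)] -/
theorem integrable_oseenKernel_fiber {τ : ℝ} (hτ : 0 < τ) (z' : (EuclideanSpace ℝ (Fin 2))) (a b : (EuclideanSpace ℝ (Fin 3))) :
    Integrable (fun r : ℝ => oseenKernel τ (sideSplit.symm (r, z')) a b) := by
  obtain ⟨C, hC, hK⟩ := exists_norm_oseenKernel_le (E := (EuclideanSpace ℝ (Fin 3)))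
  have hτ' : 0 < τ + ‖z'‖ ^ 2 := by positivity
  have he : (Module.finrank ℝ ℝ : ℝ) < 2 * 2 := by rw [Module.finrank_self]; norm_num
  have hw := integrable_add_norm_sq_rpow_neg (E := ℝ) he hτ'
  refine ((hw.const_mul (C * ‖a‖ * ‖b‖))).mono'
    (measurable_oseenKernel_fiber τ z' a b).aestronglyMeasurable (ae_of_all _ fun r => ?_)
  have h1 := hK hτ (sideSplit.symm (r, z')) a b
  have h3 : (Module.finrank ℝ (EuclideanSpace ℝ (Fin 3)) : ℝ) = 3 := by simp
  rw [h3, norm_sq_sideSplit_symm] at h1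
  have h4 : (τ + (r ^ 2 + ‖z'‖ ^ 2)) ^ (-(((3:ℝ) + 1) / 2)) = (τ + ‖z'‖ ^ 2 + ‖r‖ ^ 2) ^ (-(2:ℝ)) := by
    rw [Real.norm_eq_abs, sq_abs]
    congr 1 <;> ring
  rw [h4] at h1
  calc ‖oseenKernel τ (sideSplit.symm (r, z')) a b‖
      ≤ C * (τ + ‖z'‖ ^ 2 + ‖r‖ ^ 2) ^ (-(2:ℝ)) * ‖a‖ * ‖b‖ := h1
    _ = C * ‖a‖ * ‖b‖ * (τ + ‖z'‖ ^ 2 + ‖r‖ ^ 2) ^ (-(2:ℝ)) := by ring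

/-- **The fibre integral of the three-dimensional Oseen kernel.** [cite: KochNadirashviliSereginSverak2009, proof of Thm 6.2 (arXiv p. 13), the planar reduction, with §3 p. 6 (the kernel K_{ijk})] -/
theorem integral_oseenKernel_fiber {τ : ℝ} (hτ : 0 < τ) (z' a' b' : (EuclideanSpace ℝ (Fin 2))) (a₁ b₁ : ℝ) :
    ∫ r, oseenKernel τ (sideSplit.symm (r, z')) (sideSplit.symm (a₁, a')) (sideSplit.symm (b₁, b')) =
      sideSplit.symm (-(⟪z', a'⟫ / (2 * τ) * UnboundedOperators.heatKernel τ z' * b₁),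
        oseenKernel τ z' a' b') := by
  -- the scalar weights along the fibre and their evenness
  set G : ℝ → ℝ := fun r => UnboundedOperators.heatKernel τ (sideSplit.symm (r, z')) with hG
  set A : ℝ → ℝ := fun r => oseenWeightA τ (sideSplit.symm (r, z')) with hA
  set B : ℝ → ℝ := fun r => oseenWeightB τ (sideSplit.symm (r, z')) with hB
  have hGe : ∀ r, G (-r) = G r := fun r => heatKernel_eq_of_norm_eq (norm_sideSplit_symm_neg r z') _
  have hAe : ∀ r, A (-r) = A r := fun r =>
    oseenWeightA_eq_of_norm_eq (norm_sideSplit_symm_neg r z') _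
  have hBe : ∀ r, B (-r) = B r := fun r =>
    oseenWeightB_eq_of_norm_eq (norm_sideSplit_symm_neg r z') _
  obtain ⟨hAi, hAv⟩ := integrable_oseenWeightA_fiber hτ z'
  obtain ⟨hBi, hBv⟩ := integrable_oseenWeightB_fiber hτ z'
  obtain ⟨hB2i, hB2v⟩ := integrable_sq_mul_oseenWeightB_fiber hτ z'
  have hGi : Integrable G := integrable_heatKernel_sideSplit_symm hτ z'
  have hGv : ∫ r, G r = UnboundedOperators.heatKernel τ z' := integral_heatKernel_sideSplit_symm hτ z'
  -- names for the vectors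
  set a : (EuclideanSpace ℝ (Fin 3)) := sideSplit.symm (a₁, a') with ha
  set b : (EuclideanSpace ℝ (Fin 3)) := sideSplit.symm (b₁, b') with hb
  set α : ℝ := ⟪z', a'⟫ with hα
  set β : ℝ := ⟪z', b'⟫ with hβ
  have hab : ⟪a, b⟫ = a₁ * b₁ + ⟪a', b'⟫ := inner_sideSplit_symm_sideSplit_symm _ _ _ _
  -- even and odd parts
  set Ev : ℝ → (EuclideanSpace ℝ (Fin 3)) := fun r =>
    (-(α / (2 * τ) * G r)) • b + A r • (α • b + ⟪a, b⟫ • sideEmbed z' + β • a)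
      - (B r * (α * β)) • sideEmbed z' - (r ^ 2 * B r * (a₁ * b₁)) • sideEmbed z'
      - (r ^ 2 * B r * (a₁ * β + b₁ * α)) • sideAxis with hEv
  set Od : ℝ → (EuclideanSpace ℝ (Fin 3)) := fun r =>
    (-(a₁ / (2 * τ) * G r)) • b + A r • (a₁ • b + ⟪a, b⟫ • sideAxis + b₁ • a)
      - (B r * (a₁ * β + b₁ * α)) • sideEmbed z' - (B r * (r ^ 2 * (a₁ * b₁) + α * β)) • sideAxis
    with hOd
  set K : ℝ → (EuclideanSpace ℝ (Fin 3)) := fun r => oseenKernel τ (sideSplit.symm (r, z')) a b with hK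
  have hdec : ∀ r, K r = Ev r + r • Od r := by
    intro r
    have hGr : UnboundedOperators.heatKernel τ (sideSplit.symm (r, z')) = G r := rfl
    have hAr : oseenWeightA τ (sideSplit.symm (r, z')) = A r := rfl
    have hBr : oseenWeightB τ (sideSplit.symm (r, z')) = B r := rfl
    simp only [hK, hEv, hOd, oseenKernel]
    rw [hGr, hAr, hBr, inner_sideSplit_symm_sideSplit_symm r a₁ z' a',
      inner_sideSplit_symm_sideSplit_symm r b₁ z' b', sideSplit_symm_eq_add r z']
    module
  have hsum : ∀ r, K r + K (-r) = (2:ℝ) • Ev r := by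
    intro r
    rw [hdec, hdec]
    have e1 : Ev (-r) = Ev r := by simp only [hEv, hGe, hAe, hBe, neg_sq]
    have e2 : Od (-r) = Od r := by simp only [hOd, hGe, hAe, hBe, neg_sq]
    rw [e1, e2]
    module
  -- integrability
  have hKi : Integrable K := integrable_oseenKernel_fiber hτ z' a b
  have hKni : Integrable (fun r => K (-r)) := hKi.comp_neg
  have t1 : Integrable (fun r => (-(α / (2 * τ) * G r)) • b) := ((hGi.const_mul _).neg).smul_const _
  have t2 : Integrable (fun r => A r • (α • b + ⟪a, b⟫ • sideEmbed z' + β • a)) :=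
    hAi.smul_const _
  have t3 : Integrable (fun r => (B r * (α * β)) • sideEmbed z') := (hBi.mul_const _).smul_const _
  have t4 : Integrable (fun r => (r ^ 2 * B r * (a₁ * b₁)) • sideEmbed z') :=
    (hB2i.mul_const (a₁ * b₁)).smul_const _
  have t5 : Integrable (fun r => (r ^ 2 * B r * (a₁ * β + b₁ * α)) • sideAxis) :=
    (hB2i.mul_const (a₁ * β + b₁ * α)).smul_const _
  have hEvi : Integrable Ev := (((t1.add t2).sub t3).sub t4).sub t5
  -- `∫ K = ∫ Ev`
  have hKE : ∫ r, K r = ∫ r, Ev r := by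
    have h1 : ∫ r, K (-r) = ∫ r, K r := integral_neg_eq_self K volume
    have h2 : ∫ r, (K r + K (-r)) = (∫ r, K r) + ∫ r, K (-r) := integral_add hKi hKni
    have h3 : ∫ r, (K r + K (-r)) = ∫ r, (2:ℝ) • Ev r := integral_congr_ae (ae_of_all _ hsum)
    rw [integral_smul, h2, h1, ← two_smul ℝ] at h3
    exact smul_right_injective _ (two_ne_zero' ℝ) h3
  -- `∫ Ev`
  have hEv_int : ∫ r, Ev r =
      (-(α / (2 * τ) * UnboundedOperators.heatKernel τ z')) • b +
        oseenWeightA τ z' • (α • b + ⟪a, b⟫ • sideEmbed z' + β • a) -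
        (oseenWeightB τ z' * (α * β)) • sideEmbed z' -
        (oseenWeightA τ z' * (a₁ * b₁)) • sideEmbed z' -
        (oseenWeightA τ z' * (a₁ * β + b₁ * α)) • sideAxis := by
    have i1 : ∫ r, (-(α / (2 * τ) * G r)) • b = (-(α / (2 * τ) * UnboundedOperators.heatKernel τ z')) • b := by
      rw [integral_smul_const, integral_neg, integral_const_mul, hGv]
    have i2 : ∫ r, A r • (α • b + ⟪a, b⟫ • sideEmbed z' + β • a) =
        oseenWeightA τ z' • (α • b + ⟪a, b⟫ • sideEmbed z' + β • a) := by
      rw [integral_smul_const]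
      exact congrArg (· • _) hAv
    have i3 : ∫ r, (B r * (α * β)) • sideEmbed z' = (oseenWeightB τ z' * (α * β)) • sideEmbed z' := by
      rw [integral_smul_const, integral_mul_const]
      exact congrArg (fun t => (t * _) • _) hBv
    have i4 : ∫ r, (r ^ 2 * B r * (a₁ * b₁)) • sideEmbed z' =
        (oseenWeightA τ z' * (a₁ * b₁)) • sideEmbed z' := by
      rw [integral_smul_const, integral_mul_const]
      exact congrArg (fun t => (t * _) • _) hB2v
    have i5 : ∫ r, (r ^ 2 * B r * (a₁ * β + b₁ * α)) • sideAxis =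
        (oseenWeightA τ z' * (a₁ * β + b₁ * α)) • sideAxis := by
      rw [integral_smul_const, integral_mul_const]
      exact congrArg (fun t => (t * _) • _) hB2v
    have e : ∫ r, Ev r = ∫ r, ((-(α / (2 * τ) * G r)) • b +
        A r • (α • b + ⟪a, b⟫ • sideEmbed z' + β • a) - (B r * (α * β)) • sideEmbed z' -
        (r ^ 2 * B r * (a₁ * b₁)) • sideEmbed z' - (r ^ 2 * B r * (a₁ * β + b₁ * α)) • sideAxis) := rfl
    have s2 : Integrable (fun r => (-(α / (2 * τ) * G r)) • b +
        A r • (α • b + ⟪a, b⟫ • sideEmbed z' + β • a)) := t1.add t2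
    have s3 : Integrable (fun r => (-(α / (2 * τ) * G r)) • b +
        A r • (α • b + ⟪a, b⟫ • sideEmbed z' + β • a) - (B r * (α * β)) • sideEmbed z') :=
      s2.sub t3
    have s4 : Integrable (fun r => (-(α / (2 * τ) * G r)) • b +
        A r • (α • b + ⟪a, b⟫ • sideEmbed z' + β • a) - (B r * (α * β)) • sideEmbed z' -
        (r ^ 2 * B r * (a₁ * b₁)) • sideEmbed z') := s3.sub t4
    rw [e, integral_sub s4 t5, integral_sub s3 t4, integral_sub s2 t3, integral_add t1 t2, i1, i2, i3,
      i4, i5]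
  -- conclusion
  show ∫ r, K r = _
  rw [hKE, hEv_int, sideSplit_symm_eq_add, hab]
  have hav : a = sideEmbed a' + a₁ • sideAxis := sideSplit_symm_eq_add a₁ a'
  have hbv : b = sideEmbed b' + b₁ • sideAxis := sideSplit_symm_eq_add b₁ b'
  rw [hav, hbv]
  simp only [oseenKernel, map_add, map_sub, map_smul, smul_add, add_smul]
  module

end KernelFiber

/-- **The fibre integral of the kernel, general tensor slots.** [cite: KochNadirashviliSereginSverak2009, proof of Thm 6.2 (arXiv p. 13) with §3 p. 6] -/
theorem integral_oseenKernel_fiber' {τ : ℝ} (hτ : 0 < τ) (z' : (EuclideanSpace ℝ (Fin 2))) (a b : (EuclideanSpace ℝ (Fin 3))) :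
    ∫ r, oseenKernel τ (sideSplit.symm (r, z')) a b =
      sideSplit.symm (-(⟪z', sidePlane a⟫ / (2 * τ) * UnboundedOperators.heatKernel τ z' * b 1),
        oseenKernel τ z' (sidePlane a) (sidePlane b)) := by
  have h := integral_oseenKernel_fiber hτ z' (sidePlane a) (sidePlane b) (a 1) (b 1)
  rwa [sideSplit_symm_fst_sidePlane, sideSplit_symm_fst_sidePlane] at h

end Literature.Analysis.FluidPDE

end
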